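import Summits.QuantumFields.BalabanUV.Beta.MultiscaleRemainderL2
import Summits.QuantumFields.BalabanUV.Beta.CovariantTowerLocality

/-!
# Beta / MultiscaleParametrix — NODE (w4-c) OF THE O.2 SKELETON §8.9: THE PARAMETRIX OF Δ_U + Σ_j a_jG_jᵀG_j ON GENERAL
# HULLS — (3.88) `A·G′₀ = 1 − R′`, the output support of the remainder terms, `‖R′‖ ≤ q₀·ν` by finite overlap, and
# `A⁻¹ = G′₀(1 − R′)⁻¹` with `‖(1 − R′)⁻¹‖ ≤ (1 − q₀ν)⁻¹` (MODEL; any site/bond structure, any bump family)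

Gen 4 proved the Thm 3.7-SHAPE resolvent for the k-fold tower with the b05 partition at ONE scale M₀ and k-dependent
constants (`CovariantTowerParametrix`, `CovariantTowerLocality`, `CovariantTowerCover`).  This module re-runs the ALGEBRA
and the OVERLAP half for the multi-region operator `A = levelOp` with an ARBITRARY finite family of bumps `h_z`
(`Σ_z h_z² = 1`) and {0,1}-hulls `Ω₀(z) = {χ_z = 1}` subject to three LOCAL geometric clauses —
(a) every bond with an end in `supp h_z` has both ends in `Ω₀(z)` (`hbond`), and `supp h_z ⊆ Ω₀(z)` (`hsite`);
(b) `χ_z` is constant on the WEIGHTED part of every averaging block (`hχb`: the hull is a union of weighted cells);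
(c) every site lies in at most `ν` hulls —
and ONE analytic datum per box, the remainder bound `‖K(h_z)G′_zM_{h_z}‖ ≤ q₀` (supplied LEVEL-FREE by node (w4-b),
`MultiscaleRemainderL2.l2Bound_remK_dirInv`, in the instance (w4-b′)/(w4-c′)).  Results:
* §1 LOCALITY: `M_h(Δ_U)M_χ = M_hΔ_U` from (a) (`mulOp_covLap_mulOp`); the level sum COMMUTES with `M_χ` under (b)
  (`levelSum_comm_mulOp_supp`); hence `M_{h_z}AM_{χ_z} = M_{h_z}A` (`levelOp_local`), the local-inverse property
  `h_zAG′_zh_z = h_z²` for `G′_z = dirInv A χ_z` (`hloc_levelOp`, pv21 `hloc_of_dirichlet`), and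
  **`eq388_levelOp`**: `A·G′₀ = 1 − R′`, `G′₀ = Σ_z h_zG′_zh_z`, `R′ = Σ_z K(h_z)G′_zh_z` (pv21 `h388_lattice` with `K = remK`);
* §2 SUPPORT: `M_{χ_z}K(h_z) = K(h_z)` (`mulOp_mul_remK`: gen-4's two Leibniz support lemmas BY NAME + the commutation),
  so every remainder term reads AND writes only `Ω₀(z)`;
* §3 **`l2Bound_Rsum`**: `‖R′‖ ≤ q₀·ν` (gen-4 `l2Bound_sum_of_overlap` BY NAME with `χ_in = χ_out = χ_z`);
  **`parametrix_levelOp`**: for `q₀ν < 1`, `1 − R′` is a unit, `A⁻¹ = G′₀·(1 − R′)⁻¹` (pv21 `fixedPoint_of_388`) and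
  `‖(1 − R′)⁻¹‖_{ℓ²} ≤ (1 − q₀ν)⁻¹` (gen-4 `l2Bound_inverse_one_sub`) — the (3.89)/(2.38) «M sufficiently large» SHAPE with
  a threshold that is LEVEL-FREE exactly when `q₀` is (unit `b2b-balaban-beta-d4-p2`, GEN 9, MODEL crew; O.2 skeleton
  v1.4.1 §8.9 (w4-c)).

HONEST FRAMING: discharging `BetaPertH` makes Bałaban's UV stability UNCONDITIONAL — NOT the continuum limit, NOT the
Clay problem.  HONEST DEPENDENCY (verbatim): «continuum YM on T⁴ ⇐ BetaPertH ∧ nine spine estimates (0/9 proved);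
BetaPertH ⇐ (D1) ∧ (D4) ∧ CAP+tail; G-an2-4 gates asym, D1 and NE2/3/4.»  THIS MODULE DISCHARGES NOTHING of `BetaPertH`,
asserts NOTHING printed and cites nothing as a fact (ABSOLUTE RULE): [folklore] finite-dimensional operator algebra about
the pv21 component MODEL; bumps, hulls, `q₀`, `ν` are DATA.  LOCI (shape only): [B9] = `Balaban1985BackgroundPropagators`
(3.87)–(3.90) pp. 408–409, Thm 3.7 («for M sufficiently large … the series converges»); [B6] = `Balaban1984PropagatorsII`
(2.36)–(2.40) pp. 229–230.  No random-walk INDEXING of `Σ_n R′ⁿ` here (gen-5 `CovariantTowerWRS`/`RowData` pattern =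
node (w4-f)); no class change on row D4 (critical-path width 0; D4 DISCHARGE NO DATE); NOT BetaPertH, NOT continuum, NOT Clay.
-/

namespace Summit.QuantumFields.BalabanUV.Beta.MultiscaleParametrix

open Finset
open Literature.MathematicalPhysics.QuantumFieldTheory.Balaban1983to89
open B9Thm37Sum B9Thm37Glue B9Thm37GlueTorusInv B9Thm37GlueTorusCov B9Thm37GlueTorusCovComp B9Thm37GlueTorusCovLevels
open B9Thm37GlueTorusCovTowerPU (gMeanSq_comm_mulOp)
open Summit.QuantumFields.BalabanUV.Beta.CovariantTowerL2
open Summit.QuantumFields.BalabanUV.Beta.CovariantTowerParametrix (l2Bound_sum_of_overlap isUnit_one_sub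
  l2Bound_inverse_one_sub)
open Summit.QuantumFields.BalabanUV.Beta.CovariantTowerLocality (mulOp_comp_leibRemT_of_support
  mulOp_comp_covDT_leibRem_of_support)
open Summit.QuantumFields.BalabanUV.Beta.MultiscaleRemainderLeibniz
open Summit.QuantumFields.BalabanUV.Beta.MultiscaleRemainderL2

noncomputable section

/-! ## §1  Locality on general hulls and the (3.88) identity for `levelOp` -/

section MulOp

variable {X : Type}

/-- `M_a M_b = M_b` when `a·b = b` pointwise. [folklore] -/
theorem mulOp_mul_mulOp_of_mul_eq_right {a b : X → ℝ} (h : ∀ x, a x * b x = b x) : mulOp a * mulOp b = mulOp b := by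
  refine LinearMap.ext fun f => funext fun x => ?_
  simp only [Module.End.mul_apply, mulOp_apply]
  rw [← mul_assoc, h x]

end MulOp

section Local

variable {St Bd Cp J B : Type} [Fintype St] [DecidableEq St] [Fintype Bd] [Fintype Cp]
  [Fintype J] [Fintype B] [DecidableEq B]
  (src tgt : Bd → St) (c : Bd → ℝ) (Rm : Bd → Cp → Cp → ℝ)
  (blk : J → St → B) (W : J → St → ℝ) (T : J → St → Cp → Cp → ℝ)

omit [Fintype St] [DecidableEq St] [Fintype Bd] [Fintype J] [Fintype B] [DecidableEq B] in
/-- `∇_U` through `M_χ` on a bond with both ends in `{χ = 1}`. [folklore] -/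
theorem covD_mulOp_eq {χ : St → ℝ} (f : St × Cp → ℝ) {b : Bd} (hs : χ (src b) = 1) (ht : χ (tgt b) = 1) (k : Cp) :
    covD src tgt c Rm (mulOp (χ ∘ Prod.fst) f) (b, k) = covD src tgt c Rm f (b, k) := by
  simp only [covD_apply, mulOp_apply, Function.comp_apply, hs, ht, one_mul]

omit [Fintype St] [Fintype J] [Fintype B] [DecidableEq B] in
/-- **LOCALITY OF Δ_U = ∇_U*∇_U AT THE SUPPORT OF A BUMP (MODEL)**: if every bond with an end in `supp h` has both ends in
`Ω₀ = {χ = 1}` then `M_h Δ_U M_χ = M_h Δ_U` — Δ_U couples a site only to its bond-neighbours ([B9] (3.3), (3.8)).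
[cite: Balaban1985BackgroundPropagators, (3.3) p.391 + (3.8) p.392 + p.408 (Ω₀(□))] -/
theorem mulOp_covLap_mulOp {h χ : St → ℝ}
    (hbond : ∀ b, (h (src b) ≠ 0 ∨ h (tgt b) ≠ 0) → χ (src b) = 1 ∧ χ (tgt b) = 1) :
    mulOp (h ∘ Prod.fst) * (covDT src tgt c Rm ∘ₗ covD src tgt c Rm) * mulOp (χ ∘ Prod.fst) =
      mulOp (h ∘ Prod.fst) * (covDT src tgt c Rm ∘ₗ covD src tgt c Rm) := by
  refine LinearMap.ext fun f => funext fun p => ?_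
  obtain ⟨x, i⟩ := p
  simp only [Module.End.mul_apply, LinearMap.comp_apply, mulOp_apply, Function.comp_apply]
  by_cases hx : h x = 0
  · rw [hx, zero_mul, zero_mul]
  · congr 1
    rw [covDT_apply, covDT_apply]
    refine Finset.sum_congr rfl fun b _ => ?_
    by_cases ht : tgt b = x
    · obtain ⟨hs', ht'⟩ := hbond b (Or.inr (by rw [ht]; exact hx))
      simp only [covD_mulOp_eq src tgt c Rm f hs' ht']
    · by_cases hs : src b = x
      · obtain ⟨hs', ht'⟩ := hbond b (Or.inl (by rw [hs]; exact hx))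
        simp only [covD_mulOp_eq src tgt c Rm f hs' ht']
      · simp only [ht, hs, ↓reduceIte, zero_mul, sub_self]

omit [DecidableEq St] [Fintype Bd] [Fintype J] [Fintype B] in
/-- **A block term GᵀG commutes with M_χ whenever χ is constant on the WEIGHTED part of each block** (`χ = χ̄∘blk` where
`W ≠ 0`): `M_χ GᵀG = GᵀG M_χ` (pv21 `gMeanSq_comm_mulOp` for `χ̄∘blk` + the weighted-support congruences of
`MultiscaleRemainderL2`). [cite: Balaban1985BackgroundPropagators, (3.16) p.393 + (3.88) p.409] -/
theorem gMeanSq_comm_mulOp_supp (blk₁ : St → B) (W₁ : St → ℝ) (T₁ : St → Cp → Cp → ℝ) {χ : St → ℝ} (χb : B → ℝ)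
    (hχb : ∀ x, W₁ x ≠ 0 → χ x = χb (blk₁ x)) :
    mulOp (χ ∘ Prod.fst) * (gMeanT blk₁ W₁ T₁ ∘ₗ gMean blk₁ W₁ T₁) =
      (gMeanT blk₁ W₁ T₁ ∘ₗ gMean blk₁ W₁ T₁) * mulOp (χ ∘ Prod.fst) := by
  have e1 := gMean_comp_mulOp_congr blk₁ W₁ T₁ (φ := χ) (φ' := fun x => χb (blk₁ x)) hχb
  have e2 := mulOp_comp_gMeanT_congr blk₁ W₁ T₁ (φ := χ) (φ' := fun x => χb (blk₁ x)) hχb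
  have hc := gMeanSq_comm_mulOp blk₁ W₁ T₁ (χ := fun x => χb (blk₁ x)) (fun x x' h => by simp only [h])
  calc mulOp (χ ∘ Prod.fst) * (gMeanT blk₁ W₁ T₁ ∘ₗ gMean blk₁ W₁ T₁)
      = (mulOp (χ ∘ Prod.fst) ∘ₗ gMeanT blk₁ W₁ T₁) ∘ₗ gMean blk₁ W₁ T₁ := by
        rw [Module.End.mul_eq_comp, LinearMap.comp_assoc]
    _ = (mulOp ((fun x => χb (blk₁ x)) ∘ Prod.fst) ∘ₗ gMeanT blk₁ W₁ T₁) ∘ₗ gMean blk₁ W₁ T₁ := by rw [e2]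
    _ = mulOp ((fun x => χb (blk₁ x)) ∘ Prod.fst) * (gMeanT blk₁ W₁ T₁ ∘ₗ gMean blk₁ W₁ T₁) := by
        rw [Module.End.mul_eq_comp, LinearMap.comp_assoc]
    _ = (gMeanT blk₁ W₁ T₁ ∘ₗ gMean blk₁ W₁ T₁) * mulOp ((fun x => χb (blk₁ x)) ∘ Prod.fst) := hc
    _ = gMeanT blk₁ W₁ T₁ ∘ₗ (gMean blk₁ W₁ T₁ ∘ₗ mulOp ((fun x => χb (blk₁ x)) ∘ Prod.fst)) := by
        rw [Module.End.mul_eq_comp, LinearMap.comp_assoc]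
    _ = gMeanT blk₁ W₁ T₁ ∘ₗ (gMean blk₁ W₁ T₁ ∘ₗ mulOp (χ ∘ Prod.fst)) := by rw [e1]
    _ = (gMeanT blk₁ W₁ T₁ ∘ₗ gMean blk₁ W₁ T₁) * mulOp (χ ∘ Prod.fst) := by
        rw [Module.End.mul_eq_comp, LinearMap.comp_assoc]

omit [DecidableEq St] [Fintype Bd] [Fintype B] in
/-- **The level sum commutes with M_χ for χ constant on the weighted part of every level's blocks** (`χ = χ̄_j∘blk_j`
where `W_j ≠ 0`; hulls that are unions of weighted cells). [cite: Balaban1985BackgroundPropagators, (3.16) p.393 + (3.88) p.409] -/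
theorem levelSum_comm_mulOp_supp (a : J → ℝ) {χ : St → ℝ} (χb : J → B → ℝ)
    (hχb : ∀ j x, W j x ≠ 0 → χ x = χb j (blk j x)) :
    mulOp (χ ∘ Prod.fst) * levelSum blk W T a = levelSum blk W T a * mulOp (χ ∘ Prod.fst) := by
  rw [levelSum, Finset.mul_sum, Finset.sum_mul]
  refine Finset.sum_congr rfl fun j _ => ?_
  rw [mul_smul_comm, smul_mul_assoc, gMeanSq_comm_mulOp_supp (blk j) (W j) (T j) (χb j) (hχb j)]

omit [Fintype B] in
/-- **LOCALITY OF `levelOp` ON A HULL (MODEL)**: `supp h ⊆ Ω₀` (`h·χ = h`), the bond clause (a) and the weighted-block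
clause (b) ⟹ `M_h A M_χ = M_h A` for `A = Δ_U + Σ_j a_jG_jᵀG_j`. [cite: Balaban1985BackgroundPropagators, (3.23) p.394 + p.408 (Ω₀(□))] -/
theorem levelOp_local (a : J → ℝ) {h χ : St → ℝ} (h1 : ∀ x, h x * χ x = h x)
    (hbond : ∀ b, (h (src b) ≠ 0 ∨ h (tgt b) ≠ 0) → χ (src b) = 1 ∧ χ (tgt b) = 1)
    (χb : J → B → ℝ) (hχb : ∀ j x, W j x ≠ 0 → χ x = χb j (blk j x)) :
    mulOp (h ∘ Prod.fst) * levelOp src tgt c Rm blk W T a * mulOp (χ ∘ Prod.fst) =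
      mulOp (h ∘ Prod.fst) * levelOp src tgt c Rm blk W T a := by
  have h1' : ∀ p : St × Cp, (h ∘ Prod.fst) p * (χ ∘ Prod.fst) p = (h ∘ Prod.fst) p := fun p => h1 p.1
  have hdef : levelOp src tgt c Rm blk W T a = covDT src tgt c Rm ∘ₗ covD src tgt c Rm + levelSum blk W T a := rfl
  rw [hdef, mul_add, add_mul, mulOp_covLap_mulOp src tgt c Rm hbond, mul_assoc (mulOp (h ∘ Prod.fst)) (levelSum blk W T a),
    ← levelSum_comm_mulOp_supp blk W T a χb hχb, ← mul_assoc, mulOp_mul_mulOp_of_mul_eq h1']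

omit [Fintype B] in
/-- **The local-inverse property `h·A·G′_Ω₀·h = h²` for `levelOp` on a general hull** (strictly positive `A`; pv21
`hloc_of_dirichlet` + `sandwichΩ_mul_dirInv` + `levelOp_local`). [cite: Balaban1985BackgroundPropagators, (3.88) p.409 + p.394 (G′)] -/
theorem hloc_levelOp (a : J → ℝ)
    (hA : ∀ f : St × Cp → ℝ, f ≠ 0 → 0 < ∑ p, f p * levelOp src tgt c Rm blk W T a f p)
    {h χ : St → ℝ} (hχ : ∀ x, χ x = 0 ∨ χ x = 1) (h1 : ∀ x, h x * χ x = h x)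
    (hbond : ∀ b, (h (src b) ≠ 0 ∨ h (tgt b) ≠ 0) → χ (src b) = 1 ∧ χ (tgt b) = 1)
    (χb : J → B → ℝ) (hχb : ∀ j x, W j x ≠ 0 → χ x = χb j (blk j x)) :
    mulOp (h ∘ Prod.fst) * levelOp src tgt c Rm blk W T a * dirInv (levelOp src tgt c Rm blk W T a) (χ ∘ Prod.fst) *
        mulOp (h ∘ Prod.fst) = mulOp (h ∘ Prod.fst) * mulOp (h ∘ Prod.fst) :=
  hloc_of_dirichlet (sandwichΩ_mul_dirInv hA (fun p => hχ p.1)) h1' (levelOp_local src tgt c Rm blk W T a h1 hbond χb hχb)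
  where h1' : ∀ p : St × Cp, (h ∘ Prod.fst) p * (χ ∘ Prod.fst) p = (h ∘ Prod.fst) p := fun p => h1 p.1

end Local

section Sums

variable {St Bd Cp J B ι : Type} [Fintype St] [DecidableEq St] [Fintype Bd] [Fintype Cp]
  [Fintype J] [Fintype B] [DecidableEq B] [Fintype ι]
  (src tgt : Bd → St) (c : Bd → ℝ) (Rm : Bd → Cp → Cp → ℝ)
  (blk : J → St → B) (W : J → St → ℝ) (T : J → St → Cp → Cp → ℝ)

omit [Fintype St] [DecidableEq St] [Fintype Bd] [Fintype J] [Fintype B] [DecidableEq B] in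
/-- MODEL: the local part of the parametrix, `G′₀ = Σ_z h_zG′_zh_z` with `G′_z = dirInv A χ_z` ([B9] (3.87) SHAPE).
[cite: Balaban1985BackgroundPropagators, (3.87) p.409] -/
def G0sum (A : Module.End ℝ (St × Cp → ℝ)) (hs χ : ι → St → ℝ) : Module.End ℝ (St × Cp → ℝ) :=
  ∑ z, mulOp (hs z ∘ Prod.fst) * dirInv A (χ z ∘ Prod.fst) * mulOp (hs z ∘ Prod.fst)

omit [Fintype St] [Fintype J] [Fintype B] [DecidableEq B] in
/-- MODEL: the remainder `R′ = Σ_z K(h_z)G′_zh_z` of the parametrix ([B9] (3.88)–(3.90) SHAPE), `K = remK Q`.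
[cite: Balaban1985BackgroundPropagators, (3.88) p.409] -/
def Rsum (Qf A : Module.End ℝ (St × Cp → ℝ)) (hs χ : ι → St → ℝ) : Module.End ℝ (St × Cp → ℝ) :=
  ∑ z, remK src tgt c Rm Qf (hs z) * dirInv A (χ z ∘ Prod.fst) * mulOp (hs z ∘ Prod.fst)

omit [Fintype B] in
/-- **(3.88) FOR `levelOp` ON GENERAL HULLS (MODEL)**: `A·G′₀ = 1 − R′` for every finite bump family with `Σ_z h_z² = 1`
and hulls satisfying the clauses (a), (b) — pv21's `h388_lattice` with the local-inverse property DISCHARGED by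
`hloc_levelOp`. [cite: Balaban1985BackgroundPropagators, (3.87)–(3.88) pp.408–409] -/
theorem eq388_levelOp (a : J → ℝ)
    (hA : ∀ f : St × Cp → ℝ, f ≠ 0 → 0 < ∑ p, f p * levelOp src tgt c Rm blk W T a f p)
    (hs : ι → St → ℝ) (hsq : ∀ x, ∑ z, hs z x ^ 2 = 1) (χ : ι → St → ℝ) (hχ : ∀ z x, χ z x = 0 ∨ χ z x = 1)
    (hsite : ∀ z x, hs z x ≠ 0 → χ z x = 1)
    (hbond : ∀ z b, (hs z (src b) ≠ 0 ∨ hs z (tgt b) ≠ 0) → χ z (src b) = 1 ∧ χ z (tgt b) = 1)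
    (χb : ι → J → B → ℝ) (hχb : ∀ z j x, W j x ≠ 0 → χ z x = χb z j (blk j x)) :
    levelOp src tgt c Rm blk W T a * G0sum (levelOp src tgt c Rm blk W T a) hs χ =
      1 - Rsum src tgt c Rm (levelSum blk W T a) (levelOp src tgt c Rm blk W T a) hs χ := by
  have h1 : ∀ z x, hs z x * χ z x = hs z x := fun z x => by
    by_cases hx : hs z x = 0
    · rw [hx, zero_mul]
    · rw [hsite z x hx, mul_one]
  have hloc := fun z => hloc_levelOp src tgt c Rm blk W T a hA (hχ z) (h1 z) (hbond z) (χb z) (hχb z)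
  exact h388_lattice src tgt c Rm (levelSum blk W T a) hs
    (fun z => dirInv (levelOp src tgt c Rm blk W T a) (χ z ∘ Prod.fst)) hsq hloc

/-! ## §2  Support of the remainder terms -/

omit [Fintype St] [Fintype J] [Fintype B] [DecidableEq B] [Fintype ι] in
/-- **`M_χ K(h) = K(h)`** when `χ·h = h`, both ends of every bond carrying `∂h ≠ 0` lie in `Ω₀`, and `Q` commutes with
`M_χ` (gen-4 `mulOp_comp_leibRemT_of_support`, `mulOp_comp_covDT_leibRem_of_support` BY NAME). [folklore] -/
theorem mulOp_mul_remK {Qf : Module.End ℝ (St × Cp → ℝ)} {h χ : St → ℝ} (h1 : ∀ x, χ x * h x = h x)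
    (hdh : ∀ b, c b * (h (tgt b) - h (src b)) ≠ 0 → χ (src b) = 1 ∧ χ (tgt b) = 1)
    (hQ : mulOp (χ ∘ Prod.fst) * Qf = Qf * mulOp (χ ∘ Prod.fst)) :
    mulOp (χ ∘ Prod.fst) * remK src tgt c Rm Qf h = remK src tgt c Rm Qf h := by
  have hA1 := mulOp_comp_leibRemT_of_support src tgt c (Cp := Cp) h χ (fun b hb => (hdh b hb).1)
  have hA2 := mulOp_comp_covDT_leibRem_of_support src tgt c Rm h χ hdh
  have hMM : mulOp (χ ∘ Prod.fst) * mulOp (h ∘ Prod.fst) = (mulOp (h ∘ Prod.fst) : Module.End ℝ (St × Cp → ℝ)) :=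
    mulOp_mul_mulOp_of_mul_eq_right fun p => h1 p.1
  have p1 : mulOp (χ ∘ Prod.fst) * (leibRemT (Cp := Cp) src tgt c h ∘ₗ covD src tgt c Rm) =
      leibRemT src tgt c h ∘ₗ covD src tgt c Rm := by
    rw [Module.End.mul_eq_comp, ← LinearMap.comp_assoc, hA1]
  have p2 : mulOp (χ ∘ Prod.fst) * (-(covDT src tgt c Rm ∘ₗ leibRem (Cp := Cp) src tgt c h)) =
      -(covDT src tgt c Rm ∘ₗ leibRem src tgt c h) := by
    rw [Module.End.mul_eq_comp, LinearMap.comp_neg, hA2]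
  have p3 : mulOp (χ ∘ Prod.fst) * (mulOp (h ∘ Prod.fst) * Qf - Qf * mulOp (h ∘ Prod.fst)) =
      mulOp (h ∘ Prod.fst) * Qf - Qf * mulOp (h ∘ Prod.fst) := by
    rw [mul_sub, ← mul_assoc, hMM, ← mul_assoc, hQ, mul_assoc, hMM]
  rw [remK, mul_add, mul_add, p1, p2, p3]

omit [Fintype St] [DecidableEq St] [Fintype Bd] [Fintype J] [Fintype B] [DecidableEq B] [Fintype ι] in
/-- A bond carrying `∂h ≠ 0` has an end in `supp h`. [folklore] -/
theorem ends_of_dh_ne {h χ : St → ℝ} (hbond : ∀ b, (h (src b) ≠ 0 ∨ h (tgt b) ≠ 0) → χ (src b) = 1 ∧ χ (tgt b) = 1)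
    (b : Bd) (hb : c b * (h (tgt b) - h (src b)) ≠ 0) : χ (src b) = 1 ∧ χ (tgt b) = 1 := by
  apply hbond b
  by_contra hne
  push Not at hne
  apply hb
  rw [hne.1, hne.2, sub_self, mul_zero]

omit [Fintype B] [Fintype ι] in
/-- **Each remainder term reads and writes only its hull**: `S_z·M_{χ_z} = S_z` and `M_{χ_z}·S_z = S_z` for
`S_z = K(h_z)G′_zM_{h_z}`. [folklore] -/
theorem remTerm_support (a : J → ℝ) {h χ : St → ℝ} (hsite : ∀ x, h x ≠ 0 → χ x = 1)
    (hbond : ∀ b, (h (src b) ≠ 0 ∨ h (tgt b) ≠ 0) → χ (src b) = 1 ∧ χ (tgt b) = 1)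
    (χb : J → B → ℝ) (hχb : ∀ j x, W j x ≠ 0 → χ x = χb j (blk j x)) :
    remK src tgt c Rm (levelSum blk W T a) h * dirInv (levelOp src tgt c Rm blk W T a) (χ ∘ Prod.fst) *
          mulOp (h ∘ Prod.fst) * mulOp (χ ∘ Prod.fst) =
        remK src tgt c Rm (levelSum blk W T a) h * dirInv (levelOp src tgt c Rm blk W T a) (χ ∘ Prod.fst) *
          mulOp (h ∘ Prod.fst) ∧
      mulOp (χ ∘ Prod.fst) * (remK src tgt c Rm (levelSum blk W T a) h *
          dirInv (levelOp src tgt c Rm blk W T a) (χ ∘ Prod.fst) * mulOp (h ∘ Prod.fst)) =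
        remK src tgt c Rm (levelSum blk W T a) h * dirInv (levelOp src tgt c Rm blk W T a) (χ ∘ Prod.fst) *
          mulOp (h ∘ Prod.fst) := by
  have h1 : ∀ x, h x * χ x = h x := fun x => by
    by_cases hx : h x = 0
    · rw [hx, zero_mul]
    · rw [hsite x hx, mul_one]
  have h1r : ∀ x, χ x * h x = h x := fun x => by rw [mul_comm]; exact h1 x
  have hin : (mulOp (h ∘ Prod.fst) : Module.End ℝ (St × Cp → ℝ)) * mulOp (χ ∘ Prod.fst) = mulOp (h ∘ Prod.fst) :=
    mulOp_mul_mulOp_of_mul_eq fun p => h1 p.1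
  have hK := mulOp_mul_remK src tgt c Rm (Qf := levelSum blk W T a) h1r (ends_of_dh_ne src tgt c hbond)
    (levelSum_comm_mulOp_supp blk W T a χb hχb)
  refine ⟨by rw [mul_assoc, hin], by rw [← mul_assoc, ← mul_assoc, hK]⟩

/-! ## §3  ‖R′‖ ≤ q₀·ν by finite overlap; the parametrix -/

omit [Fintype B] in
/-- **`‖R′‖ ≤ q₀·ν`** (MODEL of the (3.89) smallness' GEOMETRIC half): per-box remainder bounds `‖K(h_z)G′_zM_{h_z}‖ ≤ q₀`
and at most `ν` hulls through any site ⟹ `‖Σ_z K(h_z)G′_zM_{h_z}‖_{ℓ²} ≤ q₀·ν` (gen-4 `l2Bound_sum_of_overlap` BY NAME with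
`χ_in = χ_out = χ_z`). [cite: Balaban1985BackgroundPropagators, (3.89) p.409; Balaban1984PropagatorsII, (2.38) p.229] -/
theorem l2Bound_Rsum (a : J → ℝ) (hs : ι → St → ℝ) (χ : ι → St → ℝ) (hχ : ∀ z x, χ z x = 0 ∨ χ z x = 1)
    (hsite : ∀ z x, hs z x ≠ 0 → χ z x = 1)
    (hbond : ∀ z b, (hs z (src b) ≠ 0 ∨ hs z (tgt b) ≠ 0) → χ z (src b) = 1 ∧ χ z (tgt b) = 1)
    (χb : ι → J → B → ℝ) (hχb : ∀ z j x, W j x ≠ 0 → χ z x = χb z j (blk j x))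
    {q₀ : ℝ} (hq₀ : 0 ≤ q₀)
    (hS : ∀ z, L2Bound (remK src tgt c Rm (levelSum blk W T a) (hs z) *
      dirInv (levelOp src tgt c Rm blk W T a) (χ z ∘ Prod.fst) * mulOp (hs z ∘ Prod.fst)) q₀)
    {ν : ℝ} (hν0 : 0 ≤ ν) (hν : ∀ x, ∑ z, χ z x ≤ ν) :
    L2Bound (Rsum src tgt c Rm (levelSum blk W T a) (levelOp src tgt c Rm blk W T a) hs χ) (q₀ * ν) := by
  have hsupp := fun z => remTerm_support src tgt c Rm blk W T a (hsite z) (hbond z) (χb z) (hχb z)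
  have hmain := l2Bound_sum_of_overlap
    (fun z => remK src tgt c Rm (levelSum blk W T a) (hs z) *
      dirInv (levelOp src tgt c Rm blk W T a) (χ z ∘ Prod.fst) * mulOp (hs z ∘ Prod.fst))
    (fun z => χ z ∘ Prod.fst) (fun z => χ z ∘ Prod.fst) (fun z p => hχ z p.1) (fun z p => hχ z p.1)
    (fun z => (hsupp z).1)
    (fun z v p hp => by
      have hp' : (χ z ∘ Prod.fst) p = 0 := hp
      rw [← (hsupp z).2, Module.End.mul_apply, mulOp_apply, hp', zero_mul])
    hq₀ hS hν0 hν0 (fun p => hν p.1) (fun p => hν p.1)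
  have e : q₀ * Real.sqrt (ν * ν) = q₀ * ν := by rw [Real.sqrt_mul_self hν0]
  rw [e] at hmain
  exact hmain

omit [Fintype B] in
/-- **THE PARAMETRIX OF `levelOp` ON GENERAL HULLS (MODEL; Thm 3.7 / (2.38) SHAPE with a threshold that is level-free
exactly when `q₀` is).**  Under the clauses (a), (b), the overlap bound `ν`, per-box remainder bounds `q₀` and
`q₀·ν < 1`: `1 − R′` is a unit, **`A⁻¹ = G′₀·(1 − R′)⁻¹`** and **`‖(1 − R′)⁻¹‖_{ℓ²} ≤ (1 − q₀ν)⁻¹`**.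
[cite: Balaban1985BackgroundPropagators, (3.87)–(3.90) pp.408–409 + Thm 3.7; Balaban1984PropagatorsII, (2.37)–(2.38) p.229] -/
theorem parametrix_levelOp (a : J → ℝ)
    (hA : ∀ f : St × Cp → ℝ, f ≠ 0 → 0 < ∑ p, f p * levelOp src tgt c Rm blk W T a f p)
    (hs : ι → St → ℝ) (hsq : ∀ x, ∑ z, hs z x ^ 2 = 1) (χ : ι → St → ℝ) (hχ : ∀ z x, χ z x = 0 ∨ χ z x = 1)
    (hsite : ∀ z x, hs z x ≠ 0 → χ z x = 1)
    (hbond : ∀ z b, (hs z (src b) ≠ 0 ∨ hs z (tgt b) ≠ 0) → χ z (src b) = 1 ∧ χ z (tgt b) = 1)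
    (χb : ι → J → B → ℝ) (hχb : ∀ z j x, W j x ≠ 0 → χ z x = χb z j (blk j x))
    {q₀ : ℝ} (hq₀ : 0 ≤ q₀)
    (hS : ∀ z, L2Bound (remK src tgt c Rm (levelSum blk W T a) (hs z) *
      dirInv (levelOp src tgt c Rm blk W T a) (χ z ∘ Prod.fst) * mulOp (hs z ∘ Prod.fst)) q₀)
    {ν : ℝ} (hν0 : 0 ≤ ν) (hν : ∀ x, ∑ z, χ z x ≤ ν) (hsmall : q₀ * ν < 1) :
    IsUnit (1 - Rsum src tgt c Rm (levelSum blk W T a) (levelOp src tgt c Rm blk W T a) hs χ) ∧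
      Ring.inverse (levelOp src tgt c Rm blk W T a) =
        G0sum (levelOp src tgt c Rm blk W T a) hs χ *
          Ring.inverse (1 - Rsum src tgt c Rm (levelSum blk W T a) (levelOp src tgt c Rm blk W T a) hs χ) ∧
      L2Bound (Ring.inverse (1 - Rsum src tgt c Rm (levelSum blk W T a) (levelOp src tgt c Rm blk W T a) hs χ))
        (1 - q₀ * ν)⁻¹ := by
  set A := levelOp src tgt c Rm blk W T a with hAdef
  set R := Rsum src tgt c Rm (levelSum blk W T a) A hs χ with hRdef
  set G0 := G0sum A hs χ with hG0
  have hR : L2Bound R (q₀ * ν) := l2Bound_Rsum src tgt c Rm blk W T a hs χ hχ hsite hbond χb hχb hq₀ hS hν0 hν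
  have hU : IsUnit (1 - R) := isUnit_one_sub hR hsmall
  have hAunit : IsUnit A := isUnit_of_posDef hA
  have hinv : Ring.inverse A * A = 1 := Ring.inverse_mul_cancel _ hAunit
  have h388 : A * G0 = 1 - R := eq388_levelOp src tgt c Rm blk W T a hA hs hsq χ hχ hsite hbond χb hχb
  have hfix : Ring.inverse A = G0 + Ring.inverse A * R := fixedPoint_of_388 hinv h388
  have hmul : Ring.inverse A * (1 - R) = G0 := by
    rw [mul_sub, mul_one]
    exact sub_eq_of_eq_add hfix
  have hG : Ring.inverse A = G0 * Ring.inverse (1 - R) := by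
    calc Ring.inverse A = Ring.inverse A * ((1 - R) * Ring.inverse (1 - R)) := by
          rw [Ring.mul_inverse_cancel _ hU, mul_one]
      _ = G0 * Ring.inverse (1 - R) := by rw [← mul_assoc, hmul]
  exact ⟨hU, hG, l2Bound_inverse_one_sub hR hsmall⟩

end Sums

end

end Summit.QuantumFields.BalabanUV.Beta.MultiscaleParametrix
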